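import Summits.HubbardSuperconductivity.HubbardSuperconductivity.Theorems.BalabanIRBirComplexStableXYRGaussianCoercive
import Summits.HubbardSuperconductivity.HubbardSuperconductivity.Theorems.BalabanIRBirComplexStableXYRSpinWave
import Literature.Analysis.Matrix.FiniteRangeDecomposition
import Literature.Analysis.Fourier.ConvolutionOperatorSymbol
import Mathlib.Data.ZMod.ValMinAbs
import HarnessLib

/-!
# Crux `BirComplexStableXYR` (stmt-HubbardSuperconductivity-14845): MILESTONE M1, part 1 —
# the Hessian matrix of the engine's action: form, symmetry, translation invariance, locality, bounds

Support file (prover seat 1, route BalabanIR) for the restated engine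
`…Theses.BalabanIR.BirComplexStableXYR`, line `log-concave-core-bounded-phase`, blueprint milestone M1
(`Lines/log-concave-core-bounded-phase.md` §3): "finite-range decomposition of the REAL covariance
`(KQ)⁻¹` on `(ℤ/L)²×ℤ/M` respecting translations, (R), (P), for a general positive finite-range form
`Q ≥ c₀Δ`".

The translate-summed real Hessian of the action at the aligned configuration is the quadratic form
`Q_c(u) = Re(−Σ_s Σ_n c_n (n·(u∘sh s))²)` (`gaussianCoercive`: `Q_c ≥ c₀·D`, the nearest-neighbour
Dirichlet form).  Writing `H` for its matrix (inline `Matrix.of`, entries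
`Re(−Σ_{(s,n)} c_n a_{(s,n)}(i) a_{(s,n)}(j))`, `a_{(s,n)}(j) = Σ_w n_w [sh s w = j]`) this file proves:

* `cfrd_form_eq` — `uᵀ H u = Q_c(u)`;  `cfrd_isHermitian`;  `cfrd_translationInvariant`
  (`H (i+g) (j+g) = H i j`);
* `cfrd_apply_eq_zero_of_noWindow` (locality: `H i j = 0` unless a window contains `i` and `j`),
  `cfrd_hasFiniteRange` (range `≤ 3(r−1)` in the torus `ℓ¹` metric, inline `valMinAbs` distance with
  `cfrd_tdist_self`, `cfrd_tdist_triangle`), `cfrd_hasFiniteRange_frdPiece` (every piece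
  `frdPiece (t•H) N` of the dyadic Fejér decomposition has range `≤ 2(2^N−1)·3(r−1)`);
* `cfrd_posSemidef` (from (N),(C) via `gaussianCoercive`);  `cfrd_form_le` / `cfrd_le_smul_one`
  (`H ≤ Λ_c·1`, `Λ_c := 2·normA(c)·r³`, by Cauchy–Schwarz and `x² ≤ 2eˣ`) — registered stub
  **`birHessian_le_smul_one`** of this seat on the crux item.

Part 2 (`…CovarianceFRD.lean`) adds the symbol domination and the volume-uniform finite-range
decomposition of the covariance (`birHessian_covarianceFRD`).

No definitions; sorry-free. [folklore]
-/

noncomputable section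

namespace Summit.HubbardSuperconductivity.HubbardSuperconductivity.Theorems

set_option linter.dupNamespace false -- summit = problem name (single-conjunct summit), D-0017

open scoped BigOperators Matrix ComplexConjugate
open Complex Summit.HubbardSuperconductivity.BirComplexStableXYNegative
open Literature.Probability.LatticeModels Literature.Analysis.Matrix Literature.Analysis.Fourier

section CovarianceFRD

variable {r : ℕ} {L M : ℕ} [NeZero L] [NeZero M]

-- The window linear form `a_{(s,n)}(j) = Σ_w n_w [sh s w = j]` (local abbreviation).
set_option quotPrecheck false in
local notation "aform[" L' "," M' "](" s "," n "," j ")" =>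
  ∑ w, (((n w : ℤ) : ℝ) * (if sh L' M' s w = j then (1 : ℝ) else 0))

-- The inline Hessian matrix of `Q_c` (local abbreviation).
set_option quotPrecheck false in
local notation "Hm[" c' "," L' "," M' "]" => (Matrix.of fun i j : Λ L' M' =>
  (-(∑ k : Λ L' M' × ↥((c' : Table _).support),
    (c' : Table _) k.2 * ((aform[L',M'](k.1, k.2.1, i) : ℝ) : ℂ)
      * ((aform[L',M'](k.1, k.2.1, j) : ℝ) : ℂ))).re)

/-! ## The quadratic form and its matrix -/

/-- `n·(u∘sh s) = Σ_j a_{(s,n)}(j) u_j`. [folklore] -/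
theorem cfrd_inner_eq (u : Λ L M → ℝ) (s : Λ L M) (n : Freq r) :
    ∑ w, (n w : ℝ) * u (sh L M s w) = ∑ j, (aform[L,M](s, n, j)) * u j := by
  simp only [Finset.sum_mul]
  rw [Finset.sum_comm]
  refine Finset.sum_congr rfl fun w _ => ?_
  simp only [mul_assoc, ← Finset.mul_sum]
  congr 1
  simp [Finset.sum_ite_eq]

/-- **`uᵀ H u = Q_c(u)`**: the inline matrix is the matrix of the translate-summed real Hessian.
[folklore] -/
theorem cfrd_form_eq (c : Table r) (u : Λ L M → ℝ) :
    (-∑ s : Λ L M, c.sum (fun n a => a * (((∑ w, (n w : ℝ) * u (sh L M s w)) ^ 2 : ℝ) : ℂ))).re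
      = u ⬝ᵥ (Hm[c,L,M] *ᵥ u) := by
  have hsum : (∑ s : Λ L M, c.sum (fun n a => a * (((∑ w, (n w : ℝ) * u (sh L M s w)) ^ 2 : ℝ) : ℂ)))
      = ∑ k : Λ L M × ↥c.support, c k.2 *
        ((∑ j, (aform[L,M](k.1, k.2.1, j)) * u j : ℝ) : ℂ) ^ 2 := by
    conv_rhs => rw [Fintype.sum_prod_type]
    refine Fintype.sum_congr _ _ fun s => ?_
    rw [Finsupp.sum, ← Finset.sum_coe_sort]
    refine Fintype.sum_congr _ _ fun n => ?_
    dsimp only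
    rw [cfrd_inner_eq u s (n : Freq r)]
    push_cast
    ring
  rw [hsum]
  exact sw_re_neg_sum_sq_eq_matrix (fun k : Λ L M × ↥c.support => c k.2)
    (fun k j => aform[L,M](k.1, k.2.1, j)) u

/-- The Hessian matrix is symmetric. [folklore] -/
theorem cfrd_isHermitian (c : Table r) : (Hm[c,L,M]).IsHermitian :=
  sw_matrix_isHermitian (fun k : Λ L M × ↥c.support => c k.2) (fun k j => aform[L,M](k.1, k.2.1, j))

/-! ## Translation invariance -/

omit [NeZero L] [NeZero M] in
/-- `sh (s + g) w = sh s w + g`. [folklore] -/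
theorem cfrd_sh_add (s g : Λ L M) (w : W r) : sh L M (s + g) w = sh L M s w + g := by
  rw [birAct_sh_eq_add (sh := sh L M) (fun _ _ => rfl), birAct_sh_eq_add (sh := sh L M) (fun _ _ => rfl)]
  abel

omit [NeZero L] [NeZero M] in
/-- The window forms are translation covariant: `a_{(s+g,n)}(j+g) = a_{(s,n)}(j)`. [folklore] -/
theorem cfrd_aform_add (s g j : Λ L M) (n : Freq r) :
    aform[L,M](s + g, n, j + g) = aform[L,M](s, n, j) := by
  refine Finset.sum_congr rfl fun w _ => ?_
  simp only [cfrd_sh_add, add_left_inj]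

/-- **Translation invariance of the Hessian matrix.** [folklore] -/
theorem cfrd_translationInvariant (c : Table r) : IsTranslationInvariant (Hm[c,L,M]) := by
  intro g i j
  simp only [Matrix.of_apply]
  congr 1
  congr 1
  -- reindex `(s, n) ↦ (s + g, n)`
  rw [← Equiv.sum_comp (Equiv.prodCongr (Equiv.addRight g) (Equiv.refl _))]
  refine Fintype.sum_congr _ _ fun k => ?_
  obtain ⟨s, n⟩ := k
  simp only [Equiv.prodCongr_apply, Equiv.coe_addRight, Equiv.coe_refl, Prod.map_apply, id_eq]
  rw [cfrd_aform_add, cfrd_aform_add]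

/-! ## Locality (finite range, metric-free form) -/

omit [NeZero L] [NeZero M] in
/-- A window form vanishes at a site outside its window. [folklore] -/
theorem cfrd_aform_eq_zero (s j : Λ L M) (n : Freq r) (h : ∀ w : W r, sh L M s w ≠ j) :
    aform[L,M](s, n, j) = 0 :=
  Finset.sum_eq_zero fun w _ => by rw [if_neg (h w), mul_zero]

/-- **Locality of the Hessian matrix**: `H i j = 0` unless some window contains both `i` and `j`
(so `H` has range `≤ r − 1` window steps in each coordinate; by `HasFiniteRange.aeval` every
`frdPiece A N`, a polynomial of degree `≤ 2^{N+1} − 2` in `H`, has range `< 2^{N+1}(r−1)`). [folklore] -/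
theorem cfrd_apply_eq_zero_of_noWindow (c : Table r) (i j : Λ L M)
    (h : ∀ (s : Λ L M) (w w' : W r), sh L M s w = i → sh L M s w' ≠ j) :
    (Hm[c,L,M]) i j = 0 := by
  simp only [Matrix.of_apply]
  rw [Finset.sum_eq_zero, neg_zero, Complex.zero_re]
  intro k _
  by_cases hi : ∃ w : W r, sh L M k.1 w = i
  · obtain ⟨w, hw⟩ := hi
    rw [cfrd_aform_eq_zero k.1 j k.2.1 (fun w' => h k.1 w w' hw)]
    simp
  · rw [not_exists] at hi
    rw [cfrd_aform_eq_zero k.1 i k.2.1 hi]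
    simp

/-! ## Finite range in the torus `ℓ¹` metric -/

-- the torus `ℓ¹` distance (local abbreviation; inline in statements)
set_option quotPrecheck false in
local notation "tdist[" L' "," M' "]" => (fun i j : Λ L' M' =>
  ((j.1 0 - i.1 0).valMinAbs.natAbs + (j.1 1 - i.1 1).valMinAbs.natAbs + (j.2 - i.2).valMinAbs.natAbs))

omit [NeZero L] [NeZero M] in
/-- The torus `ℓ¹` distance vanishes on the diagonal. [folklore] -/
theorem cfrd_tdist_self (i : Λ L M) : tdist[L,M] i i = 0 := by
  simp [ZMod.valMinAbs_zero]

omit [NeZero L] [NeZero M] in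
/-- One coordinate of the triangle inequality: `|a + b|_n ≤ |a|_n + |b|_n` for centred residues. [folklore] -/
theorem cfrd_valMinAbs_add_le {n : ℕ} (a b : ZMod n) :
    (a + b).valMinAbs.natAbs ≤ a.valMinAbs.natAbs + b.valMinAbs.natAbs :=
  (ZMod.natAbs_valMinAbs_add_le a b).trans (Int.natAbs_add_le _ _)

omit [NeZero L] [NeZero M] in
/-- **Triangle inequality** for the torus `ℓ¹` distance. [folklore] -/
theorem cfrd_tdist_triangle (i j k : Λ L M) : tdist[L,M] i k ≤ tdist[L,M] i j + tdist[L,M] j k := by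
  have h0 := cfrd_valMinAbs_add_le (j.1 0 - i.1 0) (k.1 0 - j.1 0)
  have h1 := cfrd_valMinAbs_add_le (j.1 1 - i.1 1) (k.1 1 - j.1 1)
  have h2 := cfrd_valMinAbs_add_le (j.2 - i.2) (k.2 - j.2)
  rw [show j.1 0 - i.1 0 + (k.1 0 - j.1 0) = k.1 0 - i.1 0 by abel] at h0
  rw [show j.1 1 - i.1 1 + (k.1 1 - j.1 1) = k.1 1 - i.1 1 by abel] at h1
  rw [show j.2 - i.2 + (k.2 - j.2) = k.2 - i.2 by abel] at h2
  simp only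
  omega

omit [NeZero L] [NeZero M] in
/-- `|(a : ℤ/n) − (b : ℤ/n)|_n ≤ r − 1` for `a, b < r`. [folklore] -/
theorem cfrd_valMinAbs_natCast_sub_le {n r : ℕ} [NeZero n] (a b : ℕ) (ha : a < r) (hb : b < r) :
    (((a : ℕ) : ZMod n) - ((b : ℕ) : ZMod n)).valMinAbs.natAbs ≤ r - 1 := by
  have hmin := ZMod.natAbs_min_of_le_div_two n ((((a : ℕ) : ZMod n) - ((b : ℕ) : ZMod n)).valMinAbs)
    ((a : ℤ) - (b : ℤ)) (by push_cast [ZMod.coe_valMinAbs]; rfl) (ZMod.natAbs_valMinAbs_le _)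
  refine hmin.trans ?_
  omega

/-- **Finite range of the Hessian matrix**: `H` has range `≤ 3(r − 1)` in the torus `ℓ¹` metric
(two sites interact only through a common `r × r × r` window). [folklore] -/
theorem cfrd_hasFiniteRange (c : Table r) : HasFiniteRange (tdist[L,M]) (3 * (r - 1)) (Hm[c,L,M]) := by
  intro i j hij
  apply cfrd_apply_eq_zero_of_noWindow
  intro s w w' hw hw'
  apply absurd hij
  apply not_lt.mpr
  -- `j − i = sh s w' − sh s w` coordinatewise
  rw [← hw, ← hw']
  rw [birAct_sh_eq_add (sh := sh L M) (fun _ _ => rfl), birAct_sh_eq_add (sh := sh L M) (fun _ _ => rfl)]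
  simp only [Prod.fst_add, Prod.snd_add, Pi.add_apply, Matrix.cons_val_zero, Matrix.cons_val_one,
    add_sub_add_left_eq_sub]
  have h0 := cfrd_valMinAbs_natCast_sub_le (n := L) (w'.1 : ℕ) (w.1 : ℕ) w'.1.isLt w.1.isLt
  have h1 := cfrd_valMinAbs_natCast_sub_le (n := L) (w'.2.1 : ℕ) (w.2.1 : ℕ) w'.2.1.isLt w.2.1.isLt
  have h2 := cfrd_valMinAbs_natCast_sub_le (n := M) (w'.2.2 : ℕ) (w.2.2 : ℕ) w'.2.2.isLt w.2.2.isLt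
  omega

/-- **Finite range of the covariance pieces**: every `frdPiece ((4/Λ)•H) N` has range
`≤ 2(2^N − 1)·3(r − 1) < 2^{N+1}·3(r−1)` in the torus `ℓ¹` metric, for every scalar `Λ`. [folklore] -/
theorem cfrd_hasFiniteRange_frdPiece (c : Table r) (t : ℝ) (N : ℕ) :
    HasFiniteRange (tdist[L,M]) (2 * (2 ^ N - 1) * (3 * (r - 1))) (frdPiece (t • Hm[c,L,M]) N) :=
  hasFiniteRange_frdPiece (fun i j k => cfrd_tdist_triangle i j k) (fun i => cfrd_tdist_self i)
    ((cfrd_hasFiniteRange c).smul t) N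

/-! ## Positivity and boundedness -/

/-- **Positivity**: under (N) and (C) the Hessian matrix is positive semidefinite
(`Q_c ≥ c₀·D ≥ 0`, `gaussianCoercive`). [folklore] -/
theorem cfrd_posSemidef (hr : 2 ≤ r) (c : Table r) {c₀ : ℝ} (hc₀ : 0 < c₀)
    (hN : c.sum (fun _ a => a) = 0)
    (hC : ∀ φ : W r → ℝ, c₀ * ∑ w, ∑ w', (1 - Real.cos (φ w - φ w')) ≤ (genF c φ).re) :
    (Hm[c,L,M]).PosSemidef := by
  refine Matrix.PosSemidef.of_dotProduct_mulVec_nonneg (cfrd_isHermitian c) fun u => ?_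
  rw [star_trivial, ← cfrd_form_eq c u]
  refine le_trans (mul_nonneg hc₀.le (Finset.sum_nonneg fun s _ => by positivity))
    (gaussianCoercive hr c hc₀ hN hC L M u)

/-- `(n·φ)² ≤ |n|₁² Σ_w φ_w²` (Cauchy–Schwarz; `Σ n_w² ≤ |n|₁²` for integer `n`). [folklore] -/
theorem cfrd_form_sq_le (n : Freq r) (φ : W r → ℝ) :
    (∑ w, (n w : ℝ) * φ w) ^ 2 ≤ (∑ w, |(n w : ℝ)|) ^ 2 * ∑ w, φ w ^ 2 := by
  have hcs := Finset.sum_mul_sq_le_sq_mul_sq Finset.univ (fun w => (n w : ℝ)) φ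
  have h1 : ∑ w, (n w : ℝ) ^ 2 ≤ (∑ w, |(n w : ℝ)|) ^ 2 := by
    rw [sq, Finset.sum_mul]
    refine Finset.sum_le_sum fun w _ => ?_
    rw [← sq_abs, sq]
    exact mul_le_mul_of_nonneg_left (Finset.single_le_sum (f := fun w' => |(n w' : ℝ)|)
      (fun w' _ => abs_nonneg _) (Finset.mem_univ w)) (abs_nonneg _)
  exact hcs.trans (mul_le_mul_of_nonneg_right h1 (Finset.sum_nonneg fun w _ => sq_nonneg _))

/-- `x² ≤ 2 eˣ` for `x ≥ 0`. [folklore] -/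
theorem cfrd_sq_le_two_mul_exp {x : ℝ} (hx : 0 ≤ x) : x ^ 2 ≤ 2 * Real.exp x := by
  have := Real.quadratic_le_exp_of_nonneg hx
  nlinarith

/-- `Σ_s Σ_w u(sh s w)² = r³ Σ_s u_s²` (every site lies in `r³` windows). [folklore] -/
theorem cfrd_sum_windows (u : Λ L M → ℝ) :
    ∑ s : Λ L M, ∑ w : W r, u (sh L M s w) ^ 2 = (r : ℝ) ^ 3 * ∑ s : Λ L M, u s ^ 2 := by
  rw [Finset.sum_comm]
  have : ∀ w : W r, ∑ s : Λ L M, u (sh L M s w) ^ 2 = ∑ s : Λ L M, u s ^ 2 := by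
    intro w
    simp_rw [birAct_sh_eq_add (sh := sh L M) (fun _ _ => rfl)]
    exact Fintype.sum_equiv (Equiv.addRight _) _ _ fun s => rfl
  simp_rw [this]
  rw [Finset.sum_const, Finset.card_univ, nsmul_eq_mul]
  have hc : Fintype.card (W r) = r ^ 3 := by
    simp only [W, Fintype.card_prod, Fintype.card_fin]; ring
  rw [hc]
  push_cast
  ring

/-- **Boundedness**: `Q_c(u) ≤ 2·normA(c)·r³·‖u‖²`. [folklore] -/
theorem cfrd_form_le (c : Table r) (u : Λ L M → ℝ) :
    u ⬝ᵥ (Hm[c,L,M] *ᵥ u) ≤ 2 * normA c * (r : ℝ) ^ 3 * (u ⬝ᵥ u) := by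
  rw [← cfrd_form_eq c u]
  -- `Re(−Σ) ≤ ‖Σ‖ ≤ Σ_s Σ_n ‖c_n‖ (n·u∘sh s)²`
  have h1 : (-∑ s : Λ L M, c.sum (fun n a => a * (((∑ w, (n w : ℝ) * u (sh L M s w)) ^ 2 : ℝ) : ℂ))).re
      ≤ ∑ s : Λ L M, c.sum (fun n a => ‖a‖ * (∑ w, (n w : ℝ) * u (sh L M s w)) ^ 2) := by
    refine (Complex.re_le_norm _).trans ?_
    rw [norm_neg]
    refine (norm_sum_le _ _).trans (Finset.sum_le_sum fun s _ => ?_)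
    rw [Finsupp.sum, Finsupp.sum]
    refine (norm_sum_le _ _).trans (Finset.sum_le_sum fun n _ => ?_)
    rw [norm_mul, Complex.norm_real, Real.norm_eq_abs, abs_of_nonneg (sq_nonneg _)]
  refine h1.trans ?_
  -- swap the sums and bound each window form
  have h2 : ∑ s : Λ L M, c.sum (fun n a => ‖a‖ * (∑ w, (n w : ℝ) * u (sh L M s w)) ^ 2)
      ≤ ∑ s : Λ L M, c.sum (fun n a => ‖a‖ * ((∑ w, |(n w : ℝ)|) ^ 2 * ∑ w : W r, u (sh L M s w) ^ 2)) := by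
    refine Finset.sum_le_sum fun s _ => ?_
    rw [Finsupp.sum, Finsupp.sum]
    refine Finset.sum_le_sum fun n _ => ?_
    exact mul_le_mul_of_nonneg_left (cfrd_form_sq_le n _) (norm_nonneg _)
  refine h2.trans ?_
  have h3 : ∑ s : Λ L M, c.sum (fun n a => ‖a‖ * ((∑ w, |(n w : ℝ)|) ^ 2 * ∑ w : W r, u (sh L M s w) ^ 2))
      = c.sum (fun n a => ‖a‖ * (∑ w, |(n w : ℝ)|) ^ 2) * ((r : ℝ) ^ 3 * ∑ s : Λ L M, u s ^ 2) := by
    rw [← cfrd_sum_windows u, Finset.mul_sum]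
    refine Finset.sum_congr rfl fun s _ => ?_
    rw [Finsupp.sum, Finsupp.sum, Finset.sum_mul]
    refine Finset.sum_congr rfl fun n _ => ?_
    ring
  rw [h3]
  have h4 : c.sum (fun n a => ‖a‖ * (∑ w, |(n w : ℝ)|) ^ 2) ≤ 2 * normA c := by
    unfold normA
    rw [Finsupp.sum, Finsupp.sum, Finset.mul_sum]
    refine Finset.sum_le_sum fun n _ => ?_
    have := cfrd_sq_le_two_mul_exp (Finset.sum_nonneg fun w (_ : w ∈ Finset.univ) => abs_nonneg ((n w : ℝ)))
    nlinarith [norm_nonneg (c n)]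
  have hu : 0 ≤ (r : ℝ) ^ 3 * ∑ s : Λ L M, u s ^ 2 := by positivity
  have hdot : u ⬝ᵥ u = ∑ s : Λ L M, u s ^ 2 := by
    simp only [dotProduct, sq]
  rw [hdot]
  nlinarith

/-- **`H ≤ Λ_c · 1`** with `Λ_c = 2·normA(c)·r³` (Loewner). [folklore] -/
theorem cfrd_le_smul_one (c : Table r) :
    ((2 * normA c * (r : ℝ) ^ 3) • (1 : Matrix (Λ L M) (Λ L M) ℝ) - Hm[c,L,M]).PosSemidef := by
  refine Matrix.PosSemidef.of_dotProduct_mulVec_nonneg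
    ((Matrix.isHermitian_one.smul (IsSelfAdjoint.all _)).sub (cfrd_isHermitian c)) fun u => ?_
  rw [star_trivial, Matrix.sub_mulVec, dotProduct_sub, Matrix.smul_mulVec, Matrix.one_mulVec,
    dotProduct_smul, smul_eq_mul]
  have := cfrd_form_le c u
  linarith

/-- **Registered stub `birHessian_le_smul_one` (prover seat 1) — the Hessian matrix of the engine's
action is bounded: `H ≤ (2·normA(c)·r³)·1`** (Loewner), for every table and every torus; together with
`cfrd_posSemidef` this places `A := (4/Λ_c)•H` in `0 ≤ A ≤ 4`, the hypothesis of the algebraic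
finite-range decomposition. [folklore] -/
theorem birHessian_le_smul_one : ∀ (r : ℕ) (c : Table r) (L M : ℕ) [NeZero L] [NeZero M], (((2 * normA c * (r : ℝ) ^ 3) • (1 : Matrix (Λ L M) (Λ L M) ℝ)) - (Matrix.of fun i j : Λ L M => (-(∑ k : Λ L M × ↥c.support, c k.2 * ((∑ w, ((k.2 : Freq r) w : ℝ) * (if sh L M k.1 w = i then (1 : ℝ) else 0) : ℝ) : ℂ) * ((∑ w, ((k.2 : Freq r) w : ℝ) * (if sh L M k.1 w = j then (1 : ℝ) else 0) : ℝ) : ℂ))).re)).PosSemidef :=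
  fun _ c _ _ _ _ => cfrd_le_smul_one c

end CovarianceFRD

end Summit.HubbardSuperconductivity.HubbardSuperconductivity.Theorems

end
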